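import Mathlib
import HarnessLib
import Summits.Ventures.LatticeQCDFlow.Exactness.SUNStoutLatticeLayer
import Summits.Ventures.LatticeQCDFlow.Exactness.KernelCouplingTranslation

/-!
# Exact Jacobians of the masked `SU(N)` stout layer are invariant under mask-preserving lattice translations (a.e.; everywhere if continuous), and so is its model density

HONEST FRAMING: exact (Metropolis-corrected) sampling algorithms for lattice gauge theory;
figures of merit are autocorrelation/cost numbers at stated couplings and volumes; no
continuum-physics claim.

Venture `LatticeQCDFlow` (cell pub-lqcd), topic `Exactness`; FANOUT row 10 (`eng-equiv`, engine
`latflow.equiv` `residual.py` stout layers under the direction masks of `masks.py`;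
`flows_jax.residual_flow`; acceptance suite "translation covariance 0.0e+00").  NEW WORK of the cell,
the translation twin of `SUNStoutLayerClassFunction`: the layer as a measurable automorphism
(`SUNStoutLatticeLayer.exists_measurableEquiv_sunStoutLatticeLayer`, frozen staples and
`2(d−1)|ρ| < 1`) combined with `KernelCouplingTranslation` (`sunStoutLayer_siteTranslate`: the layer
intertwines translations; `HasJacobian.jac_siteTranslate_ae_eq` / `jac_siteTranslate_eq`: exact
Jacobians of translation-equivariant automorphisms are translation invariant).  Nothing is cited as a
fact; no number; no definition; no Jacobian is constructed.  HYPOTHESES on the translation `t`: it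
preserves the mask (`p e ↔ p (e + t)`; every `t` of the width sublattice does, by
`directionMask_siteTranslate_of_ker`) and the coefficient field is translation covariant on active
links (`ρ (V·t) e = ρ V (e + t)` — constants, or a convolutional conditioner).

* **`ae_translationInvariant_jacobian_sunStoutLatticeLayer`** — EVERY measurable exact Jacobian `J`
  of the masked stout layer for `⊗_e Haar_{SU(n)}` satisfies `J (V·t) = J V` for a.e. `V`;
* **`translationInvariant_jacobian_sunStoutLatticeLayer`** — every CONTINUOUS exact Jacobian
  `j ≥ 0` (Liouville's `J` of `SUNStoutLayerJacobian`, the closed form of the determinant chain)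
  satisfies `j (V·t) = j V` for every `V`;
* **`translationInvariant_modelDensity_sunStoutLatticeLayer`** — with the layer presented as the
  measurable automorphism `Ψ`, a continuous exact Jacobian `j ≥ 0` and a translation-invariant prior
  density `r`, the push-forward density `(r / j) ∘ Ψ⁻¹` is translation invariant.

NOT here: translations moving the mask to another phase of the cycle; that a trained conditioner is
translation covariant; any number.
-/

noncomputable section

namespace Summit.Ventures.LatticeQCDFlow.Exactness

open Literature.MathematicalPhysics.QuantumFieldTheory
open Literature.MathematicalPhysics.QuantumFieldTheory.Luscher2010
open MeasureTheory
open scoped Matrix ENNReal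

variable {d L n : ℕ} [NeZero L]
  (p : Edge d L → Prop) [DecidablePred p]
  (ρ : GaugeConfig d L (Matrix.specialUnitaryGroup (Fin n) ℂ) → Edge d L → ℝ)
  (R : (e : Edge d L) → ({f : Edge d L // ¬p f} → Matrix.specialUnitaryGroup (Fin n) ℂ) → ℝ)
  (hR : ∀ V e, p e → ρ V e = R e (fun f => V f)) (hRc : ∀ e, p e → Continuous (R e))
  (h1 : ∀ e, p e → ∀ ν, ν ≠ e.2 → ¬p (e.1.shift e.2, ν))
  (h2 : ∀ e, p e → ∀ ν, ν ≠ e.2 → ¬p (e.1.shift ν, e.2))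
  (h3 : ∀ e, p e → ∀ ν, ν ≠ e.2 → ¬p (e.1, ν))
  (h4 : ∀ e, p e → ∀ ν, ν ≠ e.2 → ¬p ((e.1 - Pi.single ν 1).shift e.2, ν))
  (h5 : ∀ e, p e → ∀ ν, ν ≠ e.2 → ¬p (e.1 - Pi.single ν 1, e.2))
  (h6 : ∀ e, p e → ∀ ν, ν ≠ e.2 → ¬p (e.1 - Pi.single ν 1, ν))
  (hκ : ∀ e y, p e → 2 * (d - 1 : ℝ) * |R e y| < 1)
  (t : Site d L) (hpt : ∀ e : Edge d L, p e ↔ p (e.1 + t, e.2))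
  (hρt : ∀ (V : GaugeConfig d L (Matrix.specialUnitaryGroup (Fin n) ℂ)) (e : Edge d L), p e →
    ρ (GaugeConfig.siteTranslate t V) e = ρ V (e.1 + t, e.2))

include hR hRc h1 h2 h3 h4 h5 h6 hκ hpt hρt

/-- **Every measurable exact Jacobian of the masked `SU(N)` stout layer is invariant under
mask-preserving translations, almost everywhere** (frozen staples, `2(d−1)|ρ| < 1`, translation-covariant
coefficients; product Haar). -/
theorem ae_translationInvariant_jacobian_sunStoutLatticeLayer
    {Φ : GaugeConfig d L (Matrix.specialUnitaryGroup (Fin n) ℂ) → GaugeConfig d L (Matrix.specialUnitaryGroup (Fin n) ℂ)}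
    (hΦ : Φ = fun (V : GaugeConfig d L (Matrix.specialUnitaryGroup (Fin n) ℂ)) (e : Edge d L) =>
      if p e then
        (⟨NormedSpace.exp ((ρ V e : ℂ) • suProj (plaquetteLoopSum V e.1 e.2)),
            exp_smul_suProj_mem (ρ V e) (plaquetteLoopSum V e.1 e.2)⟩ :
          Matrix.specialUnitaryGroup (Fin n) ℂ) * V e
      else V e)
    {J : GaugeConfig d L (Matrix.specialUnitaryGroup (Fin n) ℂ) → ℝ≥0∞}
    (h : HasJacobian (Measure.pi fun _ : Edge d L => haarProbability (Matrix.specialUnitaryGroup (Fin n) ℂ)) Φ J) :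
    ∀ᵐ U ∂(Measure.pi fun _ : Edge d L => haarProbability (Matrix.specialUnitaryGroup (Fin n) ℂ)),
      J (GaugeConfig.siteTranslate t U) = J U := by
  obtain ⟨Ψ, hΨ⟩ := exists_measurableEquiv_sunStoutLatticeLayer p ρ R hR hRc h1 h2 h3 h4 h5 h6 hκ
  have hcomm : ∀ V : GaugeConfig d L (Matrix.specialUnitaryGroup (Fin n) ℂ),
      Ψ (GaugeConfig.siteTranslate t V) = GaugeConfig.siteTranslate t (Ψ V) := fun V => by
    rw [hΨ]
    exact sunStoutLayer_siteTranslate p p t ρ hpt hρt V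
  rw [hΦ, ← hΨ] at h
  exact HasJacobian.jac_siteTranslate_ae_eq (haarProbability (Matrix.specialUnitaryGroup (Fin n) ℂ)) t hcomm h

/-- **… and everywhere for a continuous exact Jacobian `j ≥ 0`** (Liouville's `J` of
`SUNStoutLayerJacobian`, or any certified continuous closed form — they coincide by
`SUNResidualLayerJacobianUnique`). -/
theorem translationInvariant_jacobian_sunStoutLatticeLayer
    {Φ : GaugeConfig d L (Matrix.specialUnitaryGroup (Fin n) ℂ) → GaugeConfig d L (Matrix.specialUnitaryGroup (Fin n) ℂ)}
    (hΦ : Φ = fun (V : GaugeConfig d L (Matrix.specialUnitaryGroup (Fin n) ℂ)) (e : Edge d L) =>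
      if p e then
        (⟨NormedSpace.exp ((ρ V e : ℂ) • suProj (plaquetteLoopSum V e.1 e.2)),
            exp_smul_suProj_mem (ρ V e) (plaquetteLoopSum V e.1 e.2)⟩ :
          Matrix.specialUnitaryGroup (Fin n) ℂ) * V e
      else V e)
    {j : GaugeConfig d L (Matrix.specialUnitaryGroup (Fin n) ℂ) → ℝ} (hj : Continuous j) (hj0 : ∀ U, 0 ≤ j U)
    (h : HasJacobian (Measure.pi fun _ : Edge d L => haarProbability (Matrix.specialUnitaryGroup (Fin n) ℂ)) Φ
      (fun U => ENNReal.ofReal (j U)))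
    (U : GaugeConfig d L (Matrix.specialUnitaryGroup (Fin n) ℂ)) : j (GaugeConfig.siteTranslate t U) = j U := by
  haveI : SecondCountableTopology (Matrix (Fin n) (Fin n) ℂ) :=
    inferInstanceAs (SecondCountableTopology (Fin n → Fin n → ℂ))
  haveI : SecondCountableTopology (Matrix.specialUnitaryGroup (Fin n) ℂ) :=
    Topology.IsEmbedding.subtypeVal.secondCountableTopology
  obtain ⟨Ψ, hΨ⟩ := exists_measurableEquiv_sunStoutLatticeLayer p ρ R hR hRc h1 h2 h3 h4 h5 h6 hκ
  have hcomm : ∀ V : GaugeConfig d L (Matrix.specialUnitaryGroup (Fin n) ℂ),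
      Ψ (GaugeConfig.siteTranslate t V) = GaugeConfig.siteTranslate t (Ψ V) := fun V => by
    rw [hΨ]
    exact sunStoutLayer_siteTranslate p p t ρ hpt hρt V
  rw [hΦ, ← hΨ] at h
  exact HasJacobian.jac_siteTranslate_eq t hcomm hj hj0 h U

omit hR hRc h1 h2 h3 h4 h5 h6 hκ in
/-- **The stout flow's model density is translation invariant** under mask-preserving translations:
with the layer presented as the measurable automorphism `Ψ`, a continuous exact Jacobian `j ≥ 0` and a
translation-invariant prior density `r`, the push-forward density `(r / j) ∘ Ψ⁻¹` satisfies
`((r/j) ∘ Ψ⁻¹) (V·t) = ((r/j) ∘ Ψ⁻¹) V`. -/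
theorem translationInvariant_modelDensity_sunStoutLatticeLayer
    (Ψ : GaugeConfig d L (Matrix.specialUnitaryGroup (Fin n) ℂ) ≃ᵐ GaugeConfig d L (Matrix.specialUnitaryGroup (Fin n) ℂ))
    (hΨ : ⇑Ψ = fun (V : GaugeConfig d L (Matrix.specialUnitaryGroup (Fin n) ℂ)) (e : Edge d L) =>
      if p e then
        (⟨NormedSpace.exp ((ρ V e : ℂ) • suProj (plaquetteLoopSum V e.1 e.2)),
            exp_smul_suProj_mem (ρ V e) (plaquetteLoopSum V e.1 e.2)⟩ :
          Matrix.specialUnitaryGroup (Fin n) ℂ) * V e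
      else V e)
    {j r : GaugeConfig d L (Matrix.specialUnitaryGroup (Fin n) ℂ) → ℝ} (hj : Continuous j) (hj0 : ∀ U, 0 ≤ j U)
    (h : HasJacobian (Measure.pi fun _ : Edge d L => haarProbability (Matrix.specialUnitaryGroup (Fin n) ℂ)) Ψ
      (fun U => ENNReal.ofReal (j U)))
    (hr : ∀ V : GaugeConfig d L (Matrix.specialUnitaryGroup (Fin n) ℂ), r (GaugeConfig.siteTranslate t V) = r V)
    (V : GaugeConfig d L (Matrix.specialUnitaryGroup (Fin n) ℂ)) :
    r (Ψ.symm (GaugeConfig.siteTranslate t V)) / j (Ψ.symm (GaugeConfig.siteTranslate t V)) =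
      r (Ψ.symm V) / j (Ψ.symm V) := by
  haveI : SecondCountableTopology (Matrix (Fin n) (Fin n) ℂ) :=
    inferInstanceAs (SecondCountableTopology (Fin n → Fin n → ℂ))
  haveI : SecondCountableTopology (Matrix.specialUnitaryGroup (Fin n) ℂ) :=
    Topology.IsEmbedding.subtypeVal.secondCountableTopology
  have hcomm : ∀ W : GaugeConfig d L (Matrix.specialUnitaryGroup (Fin n) ℂ),
      Ψ (GaugeConfig.siteTranslate t W) = GaugeConfig.siteTranslate t (Ψ W) := fun W => by
    rw [hΨ]
    exact sunStoutLayer_siteTranslate p p t ρ hpt hρt W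
  -- the inverse pass commutes with the translation as well
  have hsymm : Ψ.symm (GaugeConfig.siteTranslate t V) = GaugeConfig.siteTranslate t (Ψ.symm V) := by
    apply Ψ.injective
    rw [Ψ.apply_symm_apply, hcomm, Ψ.apply_symm_apply]
  rw [hsymm, hr, HasJacobian.jac_siteTranslate_eq t hcomm hj hj0 h (Ψ.symm V)]

end Summit.Ventures.LatticeQCDFlow.Exactness

end
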